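import Mathlib.Analysis.Calculus.Deriv.MeanValue
import Mathlib.Analysis.Calculus.ContDiff.Deriv
import Mathlib.Order.Filter.Finite
import Mathlib.Analysis.SpecialFunctions.Pow.Real
import Mathlib.Analysis.SpecialFunctions.Sqrt
import Mathlib.Order.Filter.AtTopBot.Basic
import HarnessLib

/-!
# The uniform quadratic expansion of a tilted log-partition function at the scale `√N` from uniform two-term asymptotics

Model-free real analysis behind the lane's Gaussian-mgf / moderate-deviation statements.  Let `F_N(t)` (think: `log Z_N` at log-fugacity
`θ₀ + t`, or along a line `θ₀ + t v` in a log-fugacity plane) satisfy UNIFORM TWO-TERM ASYMPTOTICS with period `p ≥ 1` on `|t| ≤ ρ`: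

  `|F_{pM+c}(t) − (pM+c)·Λ(t) − g_c(t)| ≤ ε_M → 0` for every residue `c < p`, uniformly in `|t| ≤ ρ`,

with a `C²` "free energy" `Λ` (`Λ' = Λ₁`, `Λ₁' = Λ₂`, `Λ₂` continuous at `0`) and "amplitude corrections" `g_c` continuous at `0`.  THEN (§3, ★★★
`uniform_quadratic_expansion_of_two_term`): for every `η > 0` there is `δ > 0` such that for all large `N` and ALL real `s` with `|s| ≤ δ√N`,

  `|F_N(s/√N) − F_N(0) − s√N·Λ₁(0) − Λ₂(0)·s²/2| ≤ η·s² + η`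

— the UNIFORM QUADRATIC EXPANSION («UQE») that `Literature/Probability/Moments/FiniteTiltModerateDeviations.lean` turns into moderate deviations, and whose
pointwise form (§4, `tendsto_of_uqe`: `F_N(s/√N) − F_N(0) − s√N Λ₁(0) → Λ₂(0)s²/2` for each fixed `s`) is the Gaussian limit of the moment generating function.
The lane proved instances of both by hand for each statistic (`…WidthOneContactGaussianMGF`, `…ContactModerateDeviations` §2, `…LinearContactCLT` §1); this
file does it once.

* §1 public plumbing used five times privately in the lane: `derivData_of_contDiff_two` (derivative data of a `C²` function) and
  ★ `abs_le_mul_sq_of_second_deriv_le` (`ψ(0) = ψ'(0) = 0`, `|ψ''| ≤ η` on `[−δ, δ]` ⇒ `|ψ(u)| ≤ η u²` there; hypotheses only on the interval).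
* §2 (private) `N ↦ N / p → ∞`.
* §3 ★★★ the theorem.  §4 `tendsto_of_uqe` (pointwise limits from a UQE, any filter, any scale `a_n → ∞`).

## Sources
A. Dembo, O. Zeitouni, *Large Deviations Techniques and Applications* (2010) §2.3 (local expansion of the logarithmic moment generating function; lane
statements); the two-mean-value squeeze is calculus folklore.  Nothing is quoted AS PRINTED; statements and constants are this lineage's (lane «pcv-sawmu»,
a-p5 g27).
-/

noncomputable section

open Filter Set
open scoped Topology

namespace Literature.Analysis.Asymptotics

/-! ## §1 Plumbing: derivative data of a `C²` function; the two-mean-value squeeze -/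

/-- Derivative data of a `C²` function `g : ℝ → ℝ`: `g' = deriv g` and `g'' = deriv (deriv g)` exist everywhere, `g''` is continuous, and `g''` is
bounded on every `[−τ, τ]`. [cite: DemboZeitouni2010, §2.3 (lane plumbing)] -/
theorem derivData_of_contDiff_two {g : ℝ → ℝ} (hg : ContDiff ℝ 2 g) :
    (∀ t, HasDerivAt g (deriv g t) t) ∧ (∀ t, HasDerivAt (deriv g) (deriv (deriv g) t) t) ∧
      Continuous (deriv (deriv g)) ∧ ∀ τ : ℝ, ∃ B, ∀ t ∈ Icc (-τ) τ, |deriv (deriv g) t| ≤ B := by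
  have h1 : Differentiable ℝ g := hg.differentiable (by norm_num)
  have h2 : ContDiff ℝ 1 (deriv g) :=
    (contDiff_succ_iff_deriv.1 (show ContDiff ℝ ((1 : WithTop ℕ∞) + 1) g from hg)).2.2
  have h3 : Differentiable ℝ (deriv g) := h2.differentiable (by norm_num)
  have h4 : Continuous (deriv (deriv g)) :=
    ((contDiff_succ_iff_deriv.1 (show ContDiff ℝ ((0 : WithTop ℕ∞) + 1) (deriv g) from h2)).2.2).continuous
  refine ⟨fun t => (h1 t).hasDerivAt, fun t => (h3 t).hasDerivAt, h4, fun τ => ?_⟩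
  obtain ⟨B, hB⟩ := isCompact_Icc.exists_bound_of_continuousOn (h4.continuousOn (s := Icc (-τ) τ))
  exact ⟨B, fun t ht => by simpa [Real.norm_eq_abs] using hB t ht⟩

/-- ★ **The two-mean-value squeeze.**  If `ψ(0) = 0`, `ψ' = ψ₁` on `[−δ, δ]` with `ψ₁(0) = 0`, `ψ₁' = ψ₂` on `[−δ, δ]` and `|ψ₂| ≤ η` there, then
`|ψ(u)| ≤ η·u²` for every `u ∈ [−δ, δ]` (mean value theorem twice; the sharp constant `η/2` is not needed downstream).
[cite: DemboZeitouni2010, §2.3 (lane plumbing: the second-order Taylor squeeze behind the local expansion of the log-mgf)] -/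
theorem abs_le_mul_sq_of_second_deriv_le {ψ ψ₁ ψ₂ : ℝ → ℝ} {δ η : ℝ} (h0 : ψ 0 = 0) (h10 : ψ₁ 0 = 0)
    (hd : ∀ u ∈ Icc (-δ) δ, HasDerivAt ψ (ψ₁ u) u) (hd1 : ∀ u ∈ Icc (-δ) δ, HasDerivAt ψ₁ (ψ₂ u) u)
    (hη : ∀ u ∈ Icc (-δ) δ, |ψ₂ u| ≤ η) {u : ℝ} (hu : u ∈ Icc (-δ) δ) : |ψ u| ≤ η * u ^ 2 := by
  have h0mem : (0 : ℝ) ∈ Icc (-δ) δ := ⟨by linarith [hu.1, hu.2], by linarith [hu.1, hu.2]⟩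
  have hsub : ∀ v ∈ Icc (-δ) δ, ∀ t, t ∈ Icc (min v 0) (max v 0) → t ∈ Icc (-δ) δ := fun v hv t ht =>
    ⟨le_trans (le_min hv.1 h0mem.1) ht.1, le_trans ht.2 (max_le hv.2 h0mem.2)⟩
  -- one mean-value step: `f(0) = 0`, `f' = f₁` on `[−δ, δ]`, `|f₁| ≤ K·|·|^k`-type bounds; we only need the two instances below
  have mvt : ∀ {f f₁ : ℝ → ℝ}, f 0 = 0 → (∀ t ∈ Icc (-δ) δ, HasDerivAt f (f₁ t) t) →
      ∀ v ∈ Icc (-δ) δ, v ≠ 0 → ∃ ξ ∈ Icc (-δ) δ, |ξ| ≤ |v| ∧ f v = f₁ ξ * v := by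
    intro f f₁ hf0 hfd v hv hv0
    rcases lt_or_gt_of_ne hv0 with hneg | hpos
    · obtain ⟨ξ, hξ, e⟩ := exists_hasDerivAt_eq_slope f f₁ hneg
        (fun t ht => (hfd t (hsub v hv t ⟨by rw [min_eq_left hneg.le]; exact ht.1, by rw [max_eq_right hneg.le]; exact ht.2⟩)).continuousAt.continuousWithinAt)
        (fun t ht => hfd t (hsub v hv t ⟨by rw [min_eq_left hneg.le]; exact ht.1.le, by rw [max_eq_right hneg.le]; exact ht.2.le⟩))
      refine ⟨ξ, hsub v hv ξ ⟨by rw [min_eq_left hneg.le]; exact hξ.1.le, by rw [max_eq_right hneg.le]; exact hξ.2.le⟩, ?_, ?_⟩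
      · rw [abs_of_neg hξ.2, abs_of_neg hneg]; linarith [hξ.1]
      · rw [hf0] at e
        have : 0 - f v = f₁ ξ * (0 - v) := by rw [e, div_mul_cancel₀ _ (sub_ne_zero.2 hneg.ne')]
        linarith
    · obtain ⟨ξ, hξ, e⟩ := exists_hasDerivAt_eq_slope f f₁ hpos
        (fun t ht => (hfd t (hsub v hv t ⟨by rw [min_eq_right hpos.le]; exact ht.1, by rw [max_eq_left hpos.le]; exact ht.2⟩)).continuousAt.continuousWithinAt)
        (fun t ht => hfd t (hsub v hv t ⟨by rw [min_eq_right hpos.le]; exact ht.1.le, by rw [max_eq_left hpos.le]; exact ht.2.le⟩))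
      refine ⟨ξ, hsub v hv ξ ⟨by rw [min_eq_right hpos.le]; exact hξ.1.le, by rw [max_eq_left hpos.le]; exact hξ.2.le⟩, ?_, ?_⟩
      · rw [abs_of_pos hξ.1, abs_of_pos hpos]; linarith [hξ.2]
      · rw [hf0] at e
        have : f v - 0 = f₁ ξ * (v - 0) := by rw [e, div_mul_cancel₀ _ (sub_ne_zero.2 hpos.ne')]
        linarith
  have hη0 : 0 ≤ η := le_trans (abs_nonneg _) (hη 0 h0mem)
  have step1 : ∀ v ∈ Icc (-δ) δ, |ψ₁ v| ≤ η * |v| := by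
    intro v hv
    by_cases hv0 : v = 0
    · subst hv0; rw [h10]; simp
    obtain ⟨ξ, hξ, -, e⟩ := mvt h10 hd1 v hv hv0
    rw [e, abs_mul]
    exact mul_le_mul_of_nonneg_right (hη ξ hξ) (abs_nonneg _)
  by_cases hu0 : u = 0
  · subst hu0; rw [h0]; simp
  obtain ⟨ξ, hξ, hξu, e⟩ := mvt h0 hd u hu hu0
  rw [e, abs_mul]
  calc |ψ₁ ξ| * |u| ≤ η * |ξ| * |u| := mul_le_mul_of_nonneg_right (step1 ξ hξ) (abs_nonneg _)
    _ ≤ η * |u| * |u| := by gcongr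
    _ = η * u ^ 2 := by rw [mul_assoc, ← sq, sq_abs]

/-! ## §2 Plumbing: `N / p → ∞` -/

/-- `N ↦ N / p` (natural division, `p ≥ 1`) tends to infinity (parity bookkeeping). [cite: DemboZeitouni2010, §2.3 (lane plumbing)] -/
private theorem tendsto_nat_div_atTop' {p : ℕ} (hp : 0 < p) : Tendsto (fun N : ℕ => N / p) atTop atTop :=
  tendsto_atTop_atTop.2 fun b => ⟨p * b, fun N h => (Nat.le_div_iff_mul_le hp).2 (by rw [mul_comm]; exact h)⟩

/-! ## §3 ★★★ The uniform quadratic expansion from uniform two-term asymptotics -/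

/-- ★★★ **UNIFORM QUADRATIC EXPANSION OF A TILTED LOG-PARTITION FUNCTION AT THE SCALE `√N`.**  Let `F : ℕ → ℝ → ℝ`, a `C²` function `Λ` with
`Λ' = Λ₁`, `Λ₁' = Λ₂`, `Λ₂` continuous at `0`, a period `p ≥ 1`, amplitude corrections `g_c` continuous at `0` for `c < p`, a radius `ρ > 0` and
remainders `ε_M → 0` with `|F_{pM+c}(t) − (pM+c)Λ(t) − g_c(t)| ≤ ε_M` for all `c < p`, `M`, `|t| ≤ ρ` (UNIFORM TWO-TERM ASYMPTOTICS).  Then for every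
`η > 0` there is `δ > 0` such that for all large `N` and all real `s` with `|s| ≤ δ√N`:
`|F_N(s/√N) − F_N(0) − s√N·Λ₁(0) − Λ₂(0)s²/2| ≤ η s² + η`.
Proof: `N·ψ(s/√N)` with `ψ` the second Taylor remainder of `Λ` (`|ψ(v)| ≤ (η/2)v²` near `0`, so `≤ (η/2)s²`), plus the oscillation of `g_c` at `0`
and two remainders `ε_{N/p}` (all `≤ η` for `N` large and `δ` small).
[cite: DemboZeitouni2010, §2.3 (the local quadratic expansion of the logarithmic mgf; lane statement)] -/
theorem uniform_quadratic_expansion_of_two_term {F : ℕ → ℝ → ℝ} {Λ Λ₁ Λ₂ : ℝ → ℝ} {g : ℕ → ℝ → ℝ} {p : ℕ} (hp : 0 < p)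
    {ρ : ℝ} (hρ : 0 < ρ) (hΛ : ∀ t, HasDerivAt Λ (Λ₁ t) t) (hΛ₁ : ∀ t, HasDerivAt Λ₁ (Λ₂ t) t) (hΛ₂ : ContinuousAt Λ₂ 0)
    (hg : ∀ c < p, ContinuousAt (g c) 0) {ε : ℕ → ℝ} (hε : Tendsto ε atTop (𝓝 0))
    (hrem : ∀ c < p, ∀ M : ℕ, ∀ t : ℝ, |t| ≤ ρ → |F (p * M + c) t - ((p * M + c : ℕ) : ℝ) * Λ t - g c t| ≤ ε M)
    {η : ℝ} (hη : 0 < η) :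
    ∃ δ : ℝ, 0 < δ ∧ ∀ᶠ N : ℕ in atTop, ∀ s : ℝ, |s| ≤ δ * Real.sqrt N →
      |F N (s / Real.sqrt N) - F N 0 - s * Real.sqrt N * Λ₁ 0 - Λ₂ 0 * s ^ 2 / 2| ≤ η * s ^ 2 + η := by
  -- (1) the second Taylor remainder of `Λ` at `0`
  set b := Λ₁ 0 with hb
  set σ2 := Λ₂ 0 with hσ2
  set ψ : ℝ → ℝ := fun v => Λ v - Λ 0 - b * v - σ2 * (v * v) / 2 with hψ
  set ψ1 : ℝ → ℝ := fun v => Λ₁ v - b - σ2 * v with hψ1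
  set ψ2 : ℝ → ℝ := fun v => Λ₂ v - σ2 with hψ2
  have hψd : ∀ v, HasDerivAt ψ (ψ1 v) v := by
    intro v
    have h2 : HasDerivAt (fun v : ℝ => b * v) b v := by simpa using (hasDerivAt_id v).const_mul b
    have h3 : HasDerivAt (fun v : ℝ => σ2 * (v * v) / 2) (σ2 * v) v := by
      have h := (((hasDerivAt_id' v).mul (hasDerivAt_id' v)).const_mul σ2).div_const 2
      exact h.congr_deriv (by ring)
    exact (((hΛ v).sub_const (Λ 0)).sub h2).sub h3
  have hψ1d : ∀ v, HasDerivAt ψ1 (ψ2 v) v := by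
    intro v
    have h3 : HasDerivAt (fun v : ℝ => σ2 * v) σ2 v := by simpa using (hasDerivAt_id v).const_mul σ2
    exact ((hΛ₁ v).sub_const b).sub h3
  have hψ0 : ψ 0 = 0 := by simp [hψ]
  have hψ10 : ψ1 0 = 0 := by simp [hψ1, hb]
  have hψ20 : ψ2 0 = 0 := by simp [hψ2, hσ2]
  have hc : ContinuousAt ψ2 0 := hΛ₂.sub continuousAt_const
  obtain ⟨δ₁, hδ₁, hδ₁b⟩ := (Metric.continuousAt_iff.1 hc) (η / 2) (by positivity)
  have hψb : ∀ v ∈ Icc (-(δ₁ / 2)) (δ₁ / 2), |ψ v| ≤ η / 2 * v ^ 2 := by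
    intro v hv
    refine abs_le_mul_sq_of_second_deriv_le hψ0 hψ10 (fun w _ => hψd w) (fun w _ => hψ1d w) (fun w hw => ?_) hv
    have : dist w 0 < δ₁ := by
      rw [Real.dist_eq, sub_zero]; exact lt_of_le_of_lt (abs_le.2 ⟨hw.1, hw.2⟩) (by linarith)
    have h := hδ₁b this
    rw [hψ20, Real.dist_eq, sub_zero] at h
    exact h.le
  -- (2) the amplitude corrections oscillate by at most `η/4` on `|v| ≤ δ₂`, uniformly in `c < p`
  obtain ⟨δ₂, hδ₂, hgb⟩ : ∃ δ₂ : ℝ, 0 < δ₂ ∧ ∀ c < p, ∀ v : ℝ, |v| ≤ δ₂ → |g c v - g c 0| ≤ η / 4 := by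
    have hev : ∀ c ∈ Finset.range p, ∀ᶠ v in 𝓝 (0 : ℝ), |g c v - g c 0| ≤ η / 4 := by
      intro c hc
      have h := (Metric.continuousAt_iff.1 (hg c (Finset.mem_range.1 hc))) (η / 4) (by positivity)
      obtain ⟨d, hd, hdb⟩ := h
      rw [Metric.eventually_nhds_iff]
      exact ⟨d, hd, fun v hv => by have := hdb hv; rw [Real.dist_eq] at this; exact this.le⟩
    have hall := (Filter.eventually_all_finset (Finset.range p)).2 hev
    obtain ⟨d, hd, hdb⟩ := Metric.eventually_nhds_iff.1 hall
    refine ⟨d / 2, by positivity, fun c hc v hv => hdb ?_ c (Finset.mem_range.2 hc)⟩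
    rw [Real.dist_eq, sub_zero]; linarith
  -- (3) the remainders are small for large `N`
  have hsmall : ∀ᶠ N : ℕ in atTop, |ε (N / p)| ≤ η / 8 := by
    have h := (hε.comp (tendsto_nat_div_atTop' hp)).abs
    rw [abs_zero] at h
    exact (h.eventually (Iic_mem_nhds (by positivity : (0 : ℝ) < η / 8))).mono fun N hN => hN
  -- the radius
  set δ := min (min (δ₁ / 2) δ₂) ρ with hδ
  have hδ0 : 0 < δ := by positivity
  refine ⟨δ, hδ0, ?_⟩
  filter_upwards [eventually_ge_atTop 1, hsmall] with N hN1 hsm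
  intro s hs
  have hNr : (0 : ℝ) < N := by exact_mod_cast hN1
  have hsq : 0 < Real.sqrt (N : ℝ) := Real.sqrt_pos.2 hNr
  obtain ⟨v, hv⟩ : ∃ v : ℝ, v = s / Real.sqrt N := ⟨_, rfl⟩
  rw [← hv]
  have hvabs : |v| ≤ δ := by rw [hv, abs_div, abs_of_pos hsq, div_le_iff₀ hsq]; exact hs
  have hvρ : |v| ≤ ρ := hvabs.trans (min_le_right _ _)
  have hvδ₁ : v ∈ Icc (-(δ₁ / 2)) (δ₁ / 2) := by
    have : |v| ≤ δ₁ / 2 := hvabs.trans ((min_le_left _ _).trans (min_le_left _ _))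
    exact ⟨by linarith [neg_abs_le v], by linarith [le_abs_self v]⟩
  have hvδ₂ : |v| ≤ δ₂ := hvabs.trans ((min_le_left _ _).trans (min_le_right _ _))
  have hNv : (N : ℝ) * v = s * Real.sqrt N ∧ (N : ℝ) * v ^ 2 = s ^ 2 := by
    have hNN : (N : ℝ) = Real.sqrt N * Real.sqrt N := (Real.mul_self_sqrt hNr.le).symm
    rw [hv]
    constructor
    · nth_rewrite 1 [hNN]; field_simp
    · rw [div_pow, Real.sq_sqrt hNr.le]; field_simp
  -- residue class of `N`
  obtain ⟨M, c, hc, hNMc⟩ : ∃ M c : ℕ, c < p ∧ p * M + c = N := ⟨N / p, N % p, Nat.mod_lt _ hp, Nat.div_add_mod N p⟩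
  have hMdiv : N / p = M := by
    rw [← hNMc, Nat.add_comm, Nat.add_mul_div_left _ _ hp, Nat.div_eq_of_lt hc, Nat.zero_add]
  have hrem2 : ∀ w : ℝ, |w| ≤ ρ → |F N w - N * Λ w - g c w| ≤ |ε (N / p)| := by
    intro w hw
    have key := hrem c hc M w hw
    rw [hNMc] at key
    rw [hMdiv]
    exact key.trans (le_abs_self _)
  have hr1 := hrem2 v hvρ
  have hr0 := hrem2 0 (by rw [abs_zero]; exact hρ.le)
  have hgd : |g c v - g c 0| ≤ η / 4 := hgb c hc v hvδ₂
  have hψv : |(N : ℝ) * ψ v| ≤ η / 2 * s ^ 2 := by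
    rw [abs_mul, abs_of_nonneg (Nat.cast_nonneg N)]
    calc (N : ℝ) * |ψ v| ≤ (N : ℝ) * (η / 2 * v ^ 2) := mul_le_mul_of_nonneg_left (hψb v hvδ₁) (Nat.cast_nonneg N)
      _ = η / 2 * ((N : ℝ) * v ^ 2) := by ring
      _ = η / 2 * s ^ 2 := by rw [hNv.2]
  -- the algebra
  obtain ⟨e1, e2⟩ := hNv
  have hid : F N v - F N 0 - s * Real.sqrt N * b - σ2 * s ^ 2 / 2
      = (N : ℝ) * ψ v + (g c v - g c 0) + ((F N v - N * Λ v - g c v) - (F N 0 - N * Λ 0 - g c 0)) := by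
    simp only [hψ]
    have e1' : s * Real.sqrt N * b = (N : ℝ) * v * b := by rw [e1]
    have e2' : σ2 * s ^ 2 / 2 = (N : ℝ) * v ^ 2 * σ2 / 2 := by rw [e2]; ring
    rw [e1', e2']
    ring
  rw [hid]
  calc |(N : ℝ) * ψ v + (g c v - g c 0) + ((F N v - N * Λ v - g c v) - (F N 0 - N * Λ 0 - g c 0))|
      ≤ |(N : ℝ) * ψ v| + |g c v - g c 0| + (|F N v - N * Λ v - g c v| + |F N 0 - N * Λ 0 - g c 0|) :=
        le_trans (abs_add_le _ _) (add_le_add (abs_add_le _ _) (abs_sub _ _))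
    _ ≤ η / 2 * s ^ 2 + η / 4 + (η / 8 + η / 8) := by linarith [hψv, hgd, hr1.trans hsm, hr0.trans hsm]
    _ ≤ η * s ^ 2 + η := by nlinarith [sq_nonneg s, hη]

/-! ## §4 Pointwise limits from a uniform quadratic expansion -/

/-- **A UQE gives the pointwise (Gaussian-mgf-type) limit**: if for every `η > 0` there is `δ > 0` with, eventually along `l`, `|G_n(s) − H s²/2| ≤ η s² + η`
for all `|s| ≤ δ a_n`, and `a_n → ∞`, then `G_n(s) → H s²/2` for every fixed real `s`. [cite: DemboZeitouni2010, §2.3 (lane plumbing)] -/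
theorem tendsto_of_uqe {α : Type*} {l : Filter α} {G : α → ℝ → ℝ} {a : α → ℝ} {H : ℝ} (ha : Tendsto a l atTop)
    (hU : ∀ η : ℝ, 0 < η → ∃ δ : ℝ, 0 < δ ∧ ∀ᶠ n in l, ∀ s : ℝ, |s| ≤ δ * a n → |G n s - H * s ^ 2 / 2| ≤ η * s ^ 2 + η)
    (s : ℝ) : Tendsto (fun n => G n s) l (𝓝 (H * s ^ 2 / 2)) := by
  rw [Metric.tendsto_nhds]
  intro e he
  have hη : 0 < e / (2 * (s ^ 2 + 1)) := by positivity
  obtain ⟨δ, hδ, hev⟩ := hU _ hη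
  have ha' : ∀ᶠ n in l, |s| / δ ≤ a n := ha.eventually (eventually_ge_atTop _)
  filter_upwards [hev, ha'] with n hn han
  have hs : |s| ≤ δ * a n := by rw [div_le_iff₀ hδ] at han; linarith
  have h := hn s hs
  rw [Real.dist_eq]
  refine lt_of_le_of_lt h ?_
  have : e / (2 * (s ^ 2 + 1)) * s ^ 2 + e / (2 * (s ^ 2 + 1)) = e / 2 := by field_simp
  rw [this]; linarith

/-- **The `√N`-scale specialisation**: under the conclusion of `uniform_quadratic_expansion_of_two_term`, for every fixed real `s`,
`F_N(s/√N) − F_N(0) − s√N·Λ₁(0) → Λ₂(0)·s²/2` — the form in which the lane states Gaussian limits of moment generating functions.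
[cite: DemboZeitouni2010, §2.3 (lane plumbing)] -/
theorem tendsto_of_uqe_sqrt {F : ℕ → ℝ → ℝ} {b σ2 : ℝ}
    (hU : ∀ η : ℝ, 0 < η → ∃ δ : ℝ, 0 < δ ∧ ∀ᶠ N : ℕ in atTop, ∀ s : ℝ, |s| ≤ δ * Real.sqrt N →
      |F N (s / Real.sqrt N) - F N 0 - s * Real.sqrt N * b - σ2 * s ^ 2 / 2| ≤ η * s ^ 2 + η) (s : ℝ) :
    Tendsto (fun N : ℕ => F N (s / Real.sqrt N) - F N 0 - s * Real.sqrt N * b) atTop (𝓝 (σ2 * s ^ 2 / 2)) :=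
  tendsto_of_uqe (G := fun N s => F N (s / Real.sqrt N) - F N 0 - s * Real.sqrt N * b)
    (Real.tendsto_sqrt_atTop.comp tendsto_natCast_atTop_atTop) hU s

end Literature.Analysis.Asymptotics
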